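import Mathlib
import Summits.NavierStokesRegularity.NavierStokesRegularity.Theses.SubOnsagerCeiling
import Literature.Analysis.FluidPDE.Tao2016AveragedNS.SelfSimilarCascadeBlowup
import HarnessLib

/-!
# The rung target needs the KP ceiling only PER VISCOSITY (constants after `ν` and after the horizon)
# (helper file for the crux `SubOnsagerCeiling.ForwardTailCeilingKP`, stmt-NavierStokesRegularity-27057, `--supports`;
# hand leafhand-ns-subonsagerceiling-4 gen 23 — a by-name REDUCTION for the planner, no new analysis)

Gen 22 (`Theorems/SubOnsagerCeilingSmallRatioSuffices.lean`) recorded that the route's leaf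
`Theses.TaoLadderRungTwoBreak.Target` consumes the crux `ForwardTailCeilingKP` (item 27057) only at SMALL scale ratios.
This file records the second, independent weakening: the crux is typed with `θ > 1/2` and `C` chosen BEFORE the viscosity
`ν` (a `ν`-UNIFORM subcritical ceiling), but the leaf needs NO uniformity in `ν` at all.  The reason is the tree's
`κ`-normal form of Theorem-4.2-level blow-up, `noGlobalCascade_iff_kappa` (scale covariance of the lattice, Tao §3/§4):
`NoGlobalCascade ε₀ α X₀ ↔ ∃ κ > 0, ¬HasGlobal ε₀ α κ κ 0 X₀`, so that

* `not_noGlobalCascade_iff_hasGlobal_all` — `¬NoGlobalCascade ε₀ α X₀` is EQUIVALENT to: for every `κ > 0` a global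
  `(κ, κ)`-pseudo-solution (Lemma 4.1 (4.5)–(4.11)) from the one-shell datum `X₀` at shell `0` exists;
* `not_noGlobalCascade_of_viscousGlobal` — in particular it FOLLOWS from per-viscosity global regularity: for every
  `ν > 0` some global regular `ν`-viscous solution from `X₀` at shell `0` (`ViscousGlobal ε₀ ν α X₀ X`, Tao's (4.13));
* `kp_viscousGlobal_of_perViscosityEnvelope` / `kp_not_noGlobalCascade_of_perViscosityEnvelope` — for an ORTHANT table
  (`OrthantInvariance`, a closed item kept as a hypothesis: its proof module lies in route OrthantWake's cone) the closed item
  `ForwardSourceSmoothing` turns a PER-VISCOSITY, PER-HORIZON forward-source envelope — for every `ν > 0` SOME set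
  `S ⊇ S⁺(α)`, SOME `η > 0` and, for every horizon `T`, SOME constant `C` (all chosen AFTER `ν`), bounding
  `Σ_{k=n..N} Σ_{i∈S} ½X_{i,k}(t)² ≤ C (1+ε₀)^{-(1+η)n}` along the regular non-negative local `ν`-viscous solutions on
  `[0,s]`, `s ≤ T` — into a global regular `ν`-viscous solution, hence into `¬NoGlobalCascade`;
* **`taoLadderTarget_of_kpPerViscosityEnvelope`**, **`taoLadderTarget_of_kpViscousGlobal`** — the rung target from the two
  declared residuals `NonDiagonalOrthantBreak` (stmt-27000), `NonOrthantBreak` (stmt-24640) and EITHER the per-viscosity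
  envelope OR plain per-viscosity global regularity of the KP networks proper (orthant, diagonal feeds) of `E₂(R)`, at
  SMALL RATIOS ONLY (`∀ R ≥ 1, ∃ εR > 0, ∀ ε₀ ∈ (0, εR]`);
* `kpPerViscosityEnvelope_of_fwdCeilingKPAt`, `kpPerViscosityEnvelope_of_forwardTailCeilingKP` — nothing is lost: the
  typed crux body gives the per-viscosity envelope (`η = 2θ − 1`, `C ↦ C·E₀`).

READING (for the planner).  The weakest by-name sufficient statement for the leaf on the KP class is PER-VISCOSITY GLOBAL
REGULARITY of positive solutions — for the one-mode chain exactly the Barbato–Morandin–Romito theorem (`β = 5/2`) at scale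
ratio `λ = 1 + ε₀` instead of `λ = 2` (removing the fixation `λ = 2` is posed as open in print, arXiv:1506.07480 p. 3) —
and NOT a `ν`-uniform `θ > 1/2` ceiling.  The two differ exactly in the critical borderline (a front of exponent `θ_f = 1/2`
with `ν`-dependent constants); every invariant-region certificate of the hands is `ν`-uniform anyway, so the census of
item 27057 is unchanged in substance, but a re-typed crux may quantify `∃ S θ C` AFTER `ν` (and after the horizon `T`).
HONEST FRAMING: reductions between statements about Tao-type MODEL lattice ODEs (route SubOnsagerCeiling, rung TL-M2Break);
per-viscosity regularity of the KP class at small ratio is OPEN; no stub, crux, rung target or summit is proved here and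
nothing bears on Navier–Stokes regularity.
[cite: Tao2016AveragedNS, §4 Lemma 4.1, Thm. 4.2, (4.13)] [cite: BarbatoMorandinRomito2011, Thm. 1]
-/

noncomputable section

-- the sub-problem namespace `NavierStokesRegularity.NavierStokesRegularity` is the tree's layout (D-0017)
set_option linter.dupNamespace false

namespace Summit.NavierStokesRegularity.NavierStokesRegularity.Theorems

open Set Filter
open scoped Topology
open Literature.Analysis.FluidPDE.TaoCascade
open Summit.NavierStokesRegularity.NavierStokesRegularity.Theses.SubOnsagerCeiling

/-- **κ-normal form, negated.**  `¬NoGlobalCascade ε₀ α X₀` iff for EVERY `κ > 0` a global `(κ, κ)`-pseudo-solution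
(conclusions (4.5)–(4.11) of Lemma 4.1) from the one-shell datum `X₀` at shell `0` exists. Immediate from the tree's
`noGlobalCascade_iff_kappa`. MODEL lattice statement. [cite: Tao2016AveragedNS, §4 Thm. 4.2] -/
theorem not_noGlobalCascade_iff_hasGlobal_all {ε₀ : ℝ} (hε₀ : 0 < ε₀) {m : ℕ}
    {α : Fin m → Fin m → Fin m → ℤ × ℤ × ℤ → ℝ} {X₀ : Fin m → ℝ} :
    ¬ NoGlobalCascade ε₀ α X₀ ↔ ∀ κ : ℝ, 0 < κ → HasGlobal ε₀ α κ κ 0 X₀ := by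
  rw [noGlobalCascade_iff_kappa hε₀]
  push Not
  rfl

/-- **Per-viscosity global regularity forbids Theorem-4.2 blow-up.**  If for every viscosity `ν > 0` the `ν`-viscous
lattice (4.13) of the table `α` has a global regular solution from the one-shell datum `X₀` at shell `0`, then
`¬NoGlobalCascade ε₀ α X₀`: a regular `ν`-viscous solution is a global `(ν√2, 0)`-pseudo-solution
(`hasGlobal_of_viscousGlobal`), and `κ = ν√2` ranges over all positive reals. No uniformity in `ν` is used.
MODEL lattice statement. [cite: Tao2016AveragedNS, §4 Thm. 4.2, (4.13)] -/
theorem not_noGlobalCascade_of_viscousGlobal {ε₀ : ℝ} (hε₀ : 0 < ε₀) {m : ℕ}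
    {α : Fin m → Fin m → Fin m → ℤ × ℤ × ℤ → ℝ} {X₀ : Fin m → ℝ}
    (h : ∀ ν : ℝ, 0 < ν → ∃ X : Fin m → ℤ → ℝ → ℝ, ViscousGlobal ε₀ ν α X₀ X) :
    ¬ NoGlobalCascade ε₀ α X₀ := by
  rw [not_noGlobalCascade_iff_hasGlobal_all hε₀]
  intro κ hκ
  have h2 : 0 < Real.sqrt 2 := Real.sqrt_pos.2 two_pos
  have hν : 0 < κ / Real.sqrt 2 := div_pos hκ h2
  obtain ⟨X, hX⟩ := h (κ / Real.sqrt 2) hν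
  have hG := hasGlobal_of_viscousGlobal hε₀ hν.le hX
  rw [div_mul_cancel₀ κ h2.ne'] at hG
  exact hasGlobal_mono hε₀.le hG le_rfl hκ.le

/-- **Per-viscosity, per-horizon forward-source envelope ⇒ global regular viscous solutions (orthant tables).**
For an orthant table `α ∈ E₂(R)` (sign predicate `hK`; non-negativity of regular local solutions on shells `≥ 1` is the
closed item `OrthantInvariance`, kept as the hypothesis `hI`): if for the viscosity `ν > 0`
there are a set `S` containing every forward source, an exponent gain `η > 0` and, for every horizon `T > 0`, a constant
`C` such that every regular NON-NEGATIVE local `ν`-viscous solution on `[0, s]`, `s ≤ T`, from `X₀` at shell `0` obeys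
`Σ_{k=n..N} Σ_{i∈S} ½X_{i,k}(t)² ≤ C·(1+ε₀)^{-(1+η)n}`, then a global regular `ν`-viscous solution exists — the closed item
`ForwardSourceSmoothing` (`ForwardSourceSmoothing_holds`). All constants are chosen AFTER `ν` (and `C` after `T`).
MODEL lattice statement. [cite: Tao2016AveragedNS, §4 (4.13)] -/
theorem kp_viscousGlobal_of_perViscosityEnvelope (hI : OrthantInvariance) {R ε₀ ν : ℝ} (hε₀ : 0 < ε₀) (hν : 0 < ν)
    {α : Fin 4 → Fin 4 → Fin 4 → ℤ × ℤ × ℤ → ℝ}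
    (hα : Literature.Analysis.FluidPDE.TaoCascade.InTableClass R α)
    (hK : ∀ (Y : Fin 4 → ℤ → ℝ → ℝ) (τ : ℝ), (∀ (j : Fin 4) (k : ℤ), 1 ≤ k → 0 ≤ Y j k τ) → ∀ δ : ℝ, 0 < δ →
      ∀ (i : Fin 4) (n : ℤ), 1 ≤ n → Y i n τ = 0 → 0 ≤ Literature.Analysis.FluidPDE.TaoCascade.quadTerm δ α Y i n τ)
    {X₀ : Fin 4 → ℝ}
    (hE : ∃ S : Finset (Fin 4), (∀ i, i ∉ S → ∀ j l : Fin 4, α i j l (0, 0, 1) = 0) ∧ ∃ η : ℝ, 0 < η ∧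
      ∀ T : ℝ, 0 < T → ∃ C : ℝ, ∀ s ∈ Set.Ioc (0 : ℝ) T, ∀ X : Fin 4 → ℤ → ℝ → ℝ,
        (∀ (i : Fin 4) (k : ℤ), X i k 0 = if k = 0 then X₀ i else 0) →
        (∀ (i : Fin 4) (k : ℤ), k < 0 → ∀ t : ℝ, X i k t = 0) →
        (∃ M : ℝ, ∀ (t : ℝ) (i : Fin 4) (k : ℤ), (1 + (1 + ε₀) ^ ((10 : ℝ) * k)) * |X i k t| ≤ M) →
        (∀ (i : Fin 4) (k : ℤ), Continuous (X i k)) →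
        (∀ (i : Fin 4) (k : ℤ), ∀ t ∈ Set.Icc (0 : ℝ) s, HasDerivWithinAt (X i k)
          (Literature.Analysis.FluidPDE.TaoCascade.quadTerm ε₀ α X i k t - ν * (1 + ε₀) ^ ((2 : ℝ) * k) * X i k t)
          (Set.Icc (0 : ℝ) s) t) →
        (∀ t ∈ Set.Icc (0 : ℝ) s, ∀ (i : Fin 4) (k : ℤ), 1 ≤ k → 0 ≤ X i k t) →
        ∀ n N : ℕ, n ≤ N → ∀ t ∈ Set.Icc (0 : ℝ) s,
          ∑ k ∈ Finset.Icc n N, ∑ i ∈ S, (1 / 2 : ℝ) * X i (k : ℤ) t ^ 2 ≤ C * (1 + ε₀) ^ (-((1 + η) * (n : ℝ)))) :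
    ∃ X : Fin 4 → ℤ → ℝ → ℝ, Literature.Analysis.FluidPDE.TaoCascade.ViscousGlobal ε₀ ν α X₀ X := by
  have hB : ForwardSourceSmoothing := ForwardSourceSmoothing_holds
  unfold Summit.NavierStokesRegularity.NavierStokesRegularity.Theses.SubOnsagerCeiling.OrthantInvariance at hI
  unfold Summit.NavierStokesRegularity.NavierStokesRegularity.Theses.SubOnsagerCeiling.ForwardSourceSmoothing at hB
  obtain ⟨S, hS, η, hη, H⟩ := hE
  refine hB ε₀ η R hε₀ hη α hα S hS X₀ ν hν ?_
  intro T hT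
  obtain ⟨C, HC⟩ := H T hT
  refine ⟨C, fun s hs Y hinit hlow hbd hcont hder n N hnN t ht => ?_⟩
  have hnonneg := hI ε₀ ν hε₀ hν α hK X₀ s hs.1 Y hinit hlow hbd hcont hder
  exact HC s hs Y hinit hlow hbd hcont hder hnonneg n N hnN t ht

/-- **Per-viscosity envelope ⇒ no Theorem-4.2 blow-up (orthant tables).**  If for EVERY `ν > 0` the orthant table
`α ∈ E₂(R)` admits a per-viscosity, per-horizon forward-source envelope (as in
`kp_viscousGlobal_of_perViscosityEnvelope`, every constant chosen after `ν`), then `¬NoGlobalCascade ε₀ α X₀`.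
MODEL lattice statement. [cite: Tao2016AveragedNS, §4 Thm. 4.2] -/
theorem kp_not_noGlobalCascade_of_perViscosityEnvelope (hI : OrthantInvariance) {R ε₀ : ℝ} (hε₀ : 0 < ε₀)
    {α : Fin 4 → Fin 4 → Fin 4 → ℤ × ℤ × ℤ → ℝ}
    (hα : Literature.Analysis.FluidPDE.TaoCascade.InTableClass R α)
    (hK : ∀ (Y : Fin 4 → ℤ → ℝ → ℝ) (τ : ℝ), (∀ (j : Fin 4) (k : ℤ), 1 ≤ k → 0 ≤ Y j k τ) → ∀ δ : ℝ, 0 < δ →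
      ∀ (i : Fin 4) (n : ℤ), 1 ≤ n → Y i n τ = 0 → 0 ≤ Literature.Analysis.FluidPDE.TaoCascade.quadTerm δ α Y i n τ)
    {X₀ : Fin 4 → ℝ}
    (hE : ∀ ν : ℝ, 0 < ν → ∃ S : Finset (Fin 4), (∀ i, i ∉ S → ∀ j l : Fin 4, α i j l (0, 0, 1) = 0) ∧ ∃ η : ℝ, 0 < η ∧
      ∀ T : ℝ, 0 < T → ∃ C : ℝ, ∀ s ∈ Set.Ioc (0 : ℝ) T, ∀ X : Fin 4 → ℤ → ℝ → ℝ,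
        (∀ (i : Fin 4) (k : ℤ), X i k 0 = if k = 0 then X₀ i else 0) →
        (∀ (i : Fin 4) (k : ℤ), k < 0 → ∀ t : ℝ, X i k t = 0) →
        (∃ M : ℝ, ∀ (t : ℝ) (i : Fin 4) (k : ℤ), (1 + (1 + ε₀) ^ ((10 : ℝ) * k)) * |X i k t| ≤ M) →
        (∀ (i : Fin 4) (k : ℤ), Continuous (X i k)) →
        (∀ (i : Fin 4) (k : ℤ), ∀ t ∈ Set.Icc (0 : ℝ) s, HasDerivWithinAt (X i k)
          (Literature.Analysis.FluidPDE.TaoCascade.quadTerm ε₀ α X i k t - ν * (1 + ε₀) ^ ((2 : ℝ) * k) * X i k t)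
          (Set.Icc (0 : ℝ) s) t) →
        (∀ t ∈ Set.Icc (0 : ℝ) s, ∀ (i : Fin 4) (k : ℤ), 1 ≤ k → 0 ≤ X i k t) →
        ∀ n N : ℕ, n ≤ N → ∀ t ∈ Set.Icc (0 : ℝ) s,
          ∑ k ∈ Finset.Icc n N, ∑ i ∈ S, (1 / 2 : ℝ) * X i (k : ℤ) t ^ 2 ≤ C * (1 + ε₀) ^ (-((1 + η) * (n : ℝ)))) :
    ¬ Literature.Analysis.FluidPDE.TaoCascade.NoGlobalCascade ε₀ α X₀ :=
  not_noGlobalCascade_of_viscousGlobal hε₀ fun ν hν =>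
    kp_viscousGlobal_of_perViscosityEnvelope hI hε₀ hν hα hK (hE ν hν)

/-- **THE RUNG TARGET FROM A PER-VISCOSITY KP ENVELOPE AT SMALL RATIOS.**  `Theses.TaoLadderRungTwoBreak.Target` follows from
the two declared residual cruxes `NonDiagonalOrthantBreak` (stmt-27000), `NonOrthantBreak` (stmt-24640) and, on the KP
networks proper (orthant, diagonal feeds) of `E₂(R)` at SMALL SCALE RATIOS `ε₀ ≤ εR(R)`, a forward-source envelope whose set
`S`, exponent gain `η > 0` and constants `C(T)` are all chosen AFTER the viscosity `ν` (and `C` after the horizon `T`);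
the closed item `OrthantInvariance` is kept as a hypothesis. Compare the typed crux `ForwardTailCeilingKP`: every
`ε₀ ∈ (0, 1]`, and `S, θ, C` BEFORE `ν`.  Same three-way case split as `Theses.SubOnsagerCeiling.closes`. A reduction between statements (the per-viscosity envelope is OPEN); MODEL lattice only.
[cite: Tao2016AveragedNS, §4 Thm. 4.2] -/
theorem taoLadderTarget_of_kpPerViscosityEnvelope
    (hS : ∀ R : ℝ, 1 ≤ R → ∃ εR : ℝ, 0 < εR ∧ ∀ ε₀ : ℝ, 0 < ε₀ → ε₀ ≤ εR →
      ∀ α : Fin 4 → Fin 4 → Fin 4 → ℤ × ℤ × ℤ → ℝ,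
      Literature.Analysis.FluidPDE.TaoCascade.InTableClass R α →
      (∀ (Y : Fin 4 → ℤ → ℝ → ℝ) (τ : ℝ), (∀ (j : Fin 4) (k : ℤ), 1 ≤ k → 0 ≤ Y j k τ) → ∀ δ : ℝ, 0 < δ →
        ∀ (i : Fin 4) (n : ℤ), 1 ≤ n → Y i n τ = 0 → 0 ≤ Literature.Analysis.FluidPDE.TaoCascade.quadTerm δ α Y i n τ) →
      (∀ a b i : Fin 4, a ≠ b → α a b i (0, 0, 1) = 0) →
      ∀ (X₀ : Fin 4 → ℝ) (ν : ℝ), 0 < ν →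
      ∃ S : Finset (Fin 4), (∀ i, i ∉ S → ∀ j l : Fin 4, α i j l (0, 0, 1) = 0) ∧ ∃ η : ℝ, 0 < η ∧
      ∀ T : ℝ, 0 < T → ∃ C : ℝ, ∀ s ∈ Set.Ioc (0 : ℝ) T, ∀ X : Fin 4 → ℤ → ℝ → ℝ,
        (∀ (i : Fin 4) (k : ℤ), X i k 0 = if k = 0 then X₀ i else 0) →
        (∀ (i : Fin 4) (k : ℤ), k < 0 → ∀ t : ℝ, X i k t = 0) →
        (∃ M : ℝ, ∀ (t : ℝ) (i : Fin 4) (k : ℤ), (1 + (1 + ε₀) ^ ((10 : ℝ) * k)) * |X i k t| ≤ M) →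
        (∀ (i : Fin 4) (k : ℤ), Continuous (X i k)) →
        (∀ (i : Fin 4) (k : ℤ), ∀ t ∈ Set.Icc (0 : ℝ) s, HasDerivWithinAt (X i k)
          (Literature.Analysis.FluidPDE.TaoCascade.quadTerm ε₀ α X i k t - ν * (1 + ε₀) ^ ((2 : ℝ) * k) * X i k t)
          (Set.Icc (0 : ℝ) s) t) →
        (∀ t ∈ Set.Icc (0 : ℝ) s, ∀ (i : Fin 4) (k : ℤ), 1 ≤ k → 0 ≤ X i k t) →
        ∀ n N : ℕ, n ≤ N → ∀ t ∈ Set.Icc (0 : ℝ) s,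
          ∑ k ∈ Finset.Icc n N, ∑ i ∈ S, (1 / 2 : ℝ) * X i (k : ℤ) t ^ 2 ≤ C * (1 + ε₀) ^ (-((1 + η) * (n : ℝ))))
    (h2 : OrthantInvariance) (h5 : NonDiagonalOrthantBreak) (h4 : NonOrthantBreak) :
    Summit.NavierStokesRegularity.NavierStokesRegularity.Theses.TaoLadderRungTwoBreak.Target := by
  intro R hR
  obtain ⟨εR, hεR, HS⟩ := hS R hR
  obtain ⟨ε₃, hε₃, H3⟩ := h5 R hR
  obtain ⟨ε₂, hε₂, H2⟩ := h4 R hR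
  refine ⟨min εR (min ε₃ ε₂), lt_min hεR (lt_min hε₃ hε₂), ?_⟩
  intro ε₀ h0 hle α X₀ hα
  by_cases hO : (∀ (Y : Fin 4 → ℤ → ℝ → ℝ) (τ : ℝ), (∀ (j : Fin 4) (k : ℤ), 1 ≤ k → 0 ≤ Y j k τ) → ∀ δ : ℝ, 0 < δ → ∀ (i : Fin 4) (n : ℤ), 1 ≤ n → Y i n τ = 0 → 0 ≤ Literature.Analysis.FluidPDE.TaoCascade.quadTerm δ α Y i n τ)
  · by_cases hD : (∀ a b i : Fin 4, a ≠ b → α a b i (0, 0, 1) = 0)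
    · exact kp_not_noGlobalCascade_of_perViscosityEnvelope h2 h0 hα hO
        (fun ν hν => HS ε₀ h0 (hle.trans (min_le_left _ _)) α hα hO hD X₀ ν hν)
    · exact H3 ε₀ h0 ((hle.trans (min_le_right _ _)).trans (min_le_left _ _)) α X₀ hα hO hD
  · exact H2 ε₀ h0 ((hle.trans (min_le_right _ _)).trans (min_le_right _ _)) α X₀ hα hO

/-- **THE RUNG TARGET FROM PER-VISCOSITY GLOBAL REGULARITY OF THE KP CLASS AT SMALL RATIOS.**  The leaf
`Theses.TaoLadderRungTwoBreak.Target` follows from the two declared residuals and the statement «for every `R ≥ 1` there is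
`εR > 0` such that for `ε₀ ≤ εR`, every KP network proper `α ∈ E₂(R)` (orthant, diagonal feeds), every one-shell datum
`X₀` and EVERY viscosity `ν > 0`, the `ν`-viscous lattice (4.13) has a global regular solution» — the Barbato–Morandin–Romito
shape (fixed `ν`, no rate), with no `θ`, no `C` and no uniformity in `ν`. A reduction between statements (per-viscosity
regularity of the KP class at scale ratio `1 + ε₀ ↓ 1` is OPEN); MODEL lattice only.
[cite: Tao2016AveragedNS, §4 Thm. 4.2, (4.13)] [cite: BarbatoMorandinRomito2011, Thm. 1] -/
theorem taoLadderTarget_of_kpViscousGlobal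
    (hV : ∀ R : ℝ, 1 ≤ R → ∃ εR : ℝ, 0 < εR ∧ ∀ ε₀ : ℝ, 0 < ε₀ → ε₀ ≤ εR →
      ∀ α : Fin 4 → Fin 4 → Fin 4 → ℤ × ℤ × ℤ → ℝ,
      Literature.Analysis.FluidPDE.TaoCascade.InTableClass R α →
      (∀ (Y : Fin 4 → ℤ → ℝ → ℝ) (τ : ℝ), (∀ (j : Fin 4) (k : ℤ), 1 ≤ k → 0 ≤ Y j k τ) → ∀ δ : ℝ, 0 < δ →
        ∀ (i : Fin 4) (n : ℤ), 1 ≤ n → Y i n τ = 0 → 0 ≤ Literature.Analysis.FluidPDE.TaoCascade.quadTerm δ α Y i n τ) →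
      (∀ a b i : Fin 4, a ≠ b → α a b i (0, 0, 1) = 0) →
      ∀ (X₀ : Fin 4 → ℝ) (ν : ℝ), 0 < ν →
        ∃ X : Fin 4 → ℤ → ℝ → ℝ, Literature.Analysis.FluidPDE.TaoCascade.ViscousGlobal ε₀ ν α X₀ X)
    (h5 : NonDiagonalOrthantBreak) (h4 : NonOrthantBreak) :
    Summit.NavierStokesRegularity.NavierStokesRegularity.Theses.TaoLadderRungTwoBreak.Target := by
  intro R hR
  obtain ⟨εR, hεR, HV⟩ := hV R hR
  obtain ⟨ε₃, hε₃, H3⟩ := h5 R hR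
  obtain ⟨ε₂, hε₂, H2⟩ := h4 R hR
  refine ⟨min εR (min ε₃ ε₂), lt_min hεR (lt_min hε₃ hε₂), ?_⟩
  intro ε₀ h0 hle α X₀ hα
  by_cases hO : (∀ (Y : Fin 4 → ℤ → ℝ → ℝ) (τ : ℝ), (∀ (j : Fin 4) (k : ℤ), 1 ≤ k → 0 ≤ Y j k τ) → ∀ δ : ℝ, 0 < δ → ∀ (i : Fin 4) (n : ℤ), 1 ≤ n → Y i n τ = 0 → 0 ≤ Literature.Analysis.FluidPDE.TaoCascade.quadTerm δ α Y i n τ)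
  · by_cases hD : (∀ a b i : Fin 4, a ≠ b → α a b i (0, 0, 1) = 0)
    · exact not_noGlobalCascade_of_viscousGlobal h0
        (fun ν hν => HV ε₀ h0 (hle.trans (min_le_left _ _)) α hα hO hD X₀ ν hν)
    · exact H3 ε₀ h0 ((hle.trans (min_le_right _ _)).trans (min_le_left _ _)) α X₀ hα hO hD
  · exact H2 ε₀ h0 ((hle.trans (min_le_right _ _)).trans (min_le_right _ _)) α X₀ hα hO

/-- **Nothing is lost, per table and ratio**: the body `FwdCeilingKPAt R ε₀ α` of the typed crux (set `S`, `θ > 1/2`,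
`C ≥ 0` chosen BEFORE `ν`) gives the per-viscosity, per-horizon envelope for every datum and every `ν > 0`, with
`η = 2θ − 1` and the horizon-free constant `C·E₀`. [cite: Tao2016AveragedNS, §4 (4.13)] -/
theorem kpPerViscosityEnvelope_of_fwdCeilingKPAt {R ε₀ : ℝ}
    {α : Fin 4 → Fin 4 → Fin 4 → ℤ × ℤ × ℤ → ℝ}
    (hC : Literature.Analysis.FluidPDE.TaoCascade.InTableClass R α → (∀ (Y : Fin 4 → ℤ → ℝ → ℝ) (τ : ℝ), (∀ (j : Fin 4) (k : ℤ), 1 ≤ k → 0 ≤ Y j k τ) → ∀ δ : ℝ, 0 < δ → ∀ (i : Fin 4) (n : ℤ), 1 ≤ n → Y i n τ = 0 → 0 ≤ Literature.Analysis.FluidPDE.TaoCascade.quadTerm δ α Y i n τ) → (∀ a b i : Fin 4, a ≠ b → α a b i (0, 0, 1) = 0) → ∃ S : Finset (Fin 4), (∀ i, i ∉ S → ∀ j l : Fin 4, α i j l (0, 0, 1) = 0) ∧ ∃ θ : ℝ, 1 / 2 < θ ∧ ∃ C : ℝ, 0 ≤ C ∧ ∀ ν : ℝ, 0 < ν → ∀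 (X₀ : Fin 4 → ℝ) (s : ℝ), 0 < s → ∀ X : Fin 4 → ℤ → ℝ → ℝ, (∀ (i : Fin 4) (k : ℤ), X i k 0 = if k = 0 then X₀ i else 0) → (∀ (i : Fin 4) (k : ℤ), k < 0 → ∀ t : ℝ, X i k t = 0) → (∃ M : ℝ, ∀ (t : ℝ) (i : Fin 4) (k : ℤ), (1 + (1 + ε₀) ^ ((10 : ℝ) * k)) * |X i k t| ≤ M) → (∀ (i : Fin 4) (k : ℤ), Continuous (X i k)) → (∀ (i : Fin 4) (k : ℤ), ∀ t ∈ Set.Icc (0 : ℝ) s, HasDerivWithinAt (X i k) (Literature.Analysis.FluidPDE.TaoCascade.quadTerm ε₀ α X i k t - ν * (1 + ε₀) ^ ((2 : ℝ) * k) * X i k t) (Set.Icc (0 : ℝ) s) t) → (∀ t ∈ Set.Icc (0 : ℝ) s, ∀ (i : Fin 4) (k : ℤ), 1 ≤ k → 0 ≤ X i k t) → ∀ n N : ℕ, n ≤ N → ∀ t ∈ Set.Icc (0 : ℝ) s, ∑ k ∈ Finset.Icc n N, ∑ i ∈ S, (1 / 2 : ℝ) * X i (k : ℤ) t ^ 2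 ≤ C * (∑ i : Fin 4, (1 / 2 : ℝ) * X₀ i ^ 2) * (1 + ε₀) ^ (-(2 * θ * (n : ℝ))))
    (hα : Literature.Analysis.FluidPDE.TaoCascade.InTableClass R α)
    (hK : ∀ (Y : Fin 4 → ℤ → ℝ → ℝ) (τ : ℝ), (∀ (j : Fin 4) (k : ℤ), 1 ≤ k → 0 ≤ Y j k τ) → ∀ δ : ℝ, 0 < δ →
      ∀ (i : Fin 4) (n : ℤ), 1 ≤ n → Y i n τ = 0 → 0 ≤ Literature.Analysis.FluidPDE.TaoCascade.quadTerm δ α Y i n τ)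
    (hD : ∀ a b i : Fin 4, a ≠ b → α a b i (0, 0, 1) = 0) (X₀ : Fin 4 → ℝ) {ν : ℝ} (hν : 0 < ν) :
    ∃ S : Finset (Fin 4), (∀ i, i ∉ S → ∀ j l : Fin 4, α i j l (0, 0, 1) = 0) ∧ ∃ η : ℝ, 0 < η ∧
      ∀ T : ℝ, 0 < T → ∃ C : ℝ, ∀ s ∈ Set.Ioc (0 : ℝ) T, ∀ X : Fin 4 → ℤ → ℝ → ℝ,
        (∀ (i : Fin 4) (k : ℤ), X i k 0 = if k = 0 then X₀ i else 0) →
        (∀ (i : Fin 4) (k : ℤ), k < 0 → ∀ t : ℝ, X i k t = 0) →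
        (∃ M : ℝ, ∀ (t : ℝ) (i : Fin 4) (k : ℤ), (1 + (1 + ε₀) ^ ((10 : ℝ) * k)) * |X i k t| ≤ M) →
        (∀ (i : Fin 4) (k : ℤ), Continuous (X i k)) →
        (∀ (i : Fin 4) (k : ℤ), ∀ t ∈ Set.Icc (0 : ℝ) s, HasDerivWithinAt (X i k)
          (Literature.Analysis.FluidPDE.TaoCascade.quadTerm ε₀ α X i k t - ν * (1 + ε₀) ^ ((2 : ℝ) * k) * X i k t)
          (Set.Icc (0 : ℝ) s) t) →
        (∀ t ∈ Set.Icc (0 : ℝ) s, ∀ (i : Fin 4) (k : ℤ), 1 ≤ k → 0 ≤ X i k t) →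
        ∀ n N : ℕ, n ≤ N → ∀ t ∈ Set.Icc (0 : ℝ) s,
          ∑ k ∈ Finset.Icc n N, ∑ i ∈ S, (1 / 2 : ℝ) * X i (k : ℤ) t ^ 2 ≤ C * (1 + ε₀) ^ (-((1 + η) * (n : ℝ))) := by
  obtain ⟨S, hS, θ, hθ, C, _hC0, H⟩ := hC hα hK hD
  refine ⟨S, hS, 2 * θ - 1, by linarith, fun T _hT => ⟨C * (∑ i : Fin 4, (1 / 2 : ℝ) * X₀ i ^ 2), ?_⟩⟩
  intro s hs Y hinit hlow hbd hcont hder hnonneg n N hnN t ht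
  have hceil := H ν hν X₀ s hs.1 Y hinit hlow hbd hcont hder hnonneg n N hnN t ht
  have hexp : -((1 + (2 * θ - 1)) * (n : ℝ)) = -(2 * θ * (n : ℝ)) := by ring
  rw [hexp]
  exact hceil

/-- **Nothing is lost, globally**: the typed crux `ForwardTailCeilingKP` implies the hypothesis of
`taoLadderTarget_of_kpPerViscosityEnvelope` (with `εR = 1`). [cite: Tao2016AveragedNS, §4 (4.13)] -/
theorem kpPerViscosityEnvelope_of_forwardTailCeilingKP (h : ForwardTailCeilingKP) :
    ∀ R : ℝ, 1 ≤ R → ∃ εR : ℝ, 0 < εR ∧ ∀ ε₀ : ℝ, 0 < ε₀ → ε₀ ≤ εR →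
      ∀ α : Fin 4 → Fin 4 → Fin 4 → ℤ × ℤ × ℤ → ℝ,
      Literature.Analysis.FluidPDE.TaoCascade.InTableClass R α →
      (∀ (Y : Fin 4 → ℤ → ℝ → ℝ) (τ : ℝ), (∀ (j : Fin 4) (k : ℤ), 1 ≤ k → 0 ≤ Y j k τ) → ∀ δ : ℝ, 0 < δ →
        ∀ (i : Fin 4) (n : ℤ), 1 ≤ n → Y i n τ = 0 → 0 ≤ Literature.Analysis.FluidPDE.TaoCascade.quadTerm δ α Y i n τ) →
      (∀ a b i : Fin 4, a ≠ b → α a b i (0, 0, 1) = 0) →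
      ∀ (X₀ : Fin 4 → ℝ) (ν : ℝ), 0 < ν →
      ∃ S : Finset (Fin 4), (∀ i, i ∉ S → ∀ j l : Fin 4, α i j l (0, 0, 1) = 0) ∧ ∃ η : ℝ, 0 < η ∧
      ∀ T : ℝ, 0 < T → ∃ C : ℝ, ∀ s ∈ Set.Ioc (0 : ℝ) T, ∀ X : Fin 4 → ℤ → ℝ → ℝ,
        (∀ (i : Fin 4) (k : ℤ), X i k 0 = if k = 0 then X₀ i else 0) →
        (∀ (i : Fin 4) (k : ℤ), k < 0 → ∀ t : ℝ, X i k t = 0) →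
        (∃ M : ℝ, ∀ (t : ℝ) (i : Fin 4) (k : ℤ), (1 + (1 + ε₀) ^ ((10 : ℝ) * k)) * |X i k t| ≤ M) →
        (∀ (i : Fin 4) (k : ℤ), Continuous (X i k)) →
        (∀ (i : Fin 4) (k : ℤ), ∀ t ∈ Set.Icc (0 : ℝ) s, HasDerivWithinAt (X i k)
          (Literature.Analysis.FluidPDE.TaoCascade.quadTerm ε₀ α X i k t - ν * (1 + ε₀) ^ ((2 : ℝ) * k) * X i k t)
          (Set.Icc (0 : ℝ) s) t) →
        (∀ t ∈ Set.Icc (0 : ℝ) s, ∀ (i : Fin 4) (k : ℤ), 1 ≤ k → 0 ≤ X i k t) →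
        ∀ n N : ℕ, n ≤ N → ∀ t ∈ Set.Icc (0 : ℝ) s,
          ∑ k ∈ Finset.Icc n N, ∑ i ∈ S, (1 / 2 : ℝ) * X i (k : ℤ) t ^ 2 ≤ C * (1 + ε₀) ^ (-((1 + η) * (n : ℝ))) :=
  fun R hR => ⟨1, one_pos, fun ε₀ h0 h1 α hα hK hD X₀ _ν hν =>
    kpPerViscosityEnvelope_of_fwdCeilingKPAt (h R hR ε₀ h0 h1 α) hα hK hD X₀ hν⟩

end Summit.NavierStokesRegularity.NavierStokesRegularity.Theorems

end
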